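import Summits.CriticalPhenomena.PercolationContinuityZ3.Theorems.PercNearOneGluingNoHeavyLowerTailChampionStability
import Summits.CriticalPhenomena.PercolationContinuityZ3.Theorems.PercNearOneGluingNoHeavyLowerTailQuantGapReductions
import HarnessLib

/-!
# `NoHeavyLowerTail` (stmt-CriticalPhenomena-4575) — the PAIR two-level packing QP₂ implies the quantitative pair gap QG₂
# and the registered pair stub CS₂ (`stub_championStabilityPair`), hence the crux (typed reductions)

Support file (lemma factory #8 `prim-lf-8`, gen 5; `--supports stmt-CriticalPhenomena-4575`).  No definitions, no named facts,
no sorries.  Vocabulary of `…QuantGapReductions.lean` / `…ChampionStability.lean`: `μ = prodBernoulli w` on `Fin n`, relays `A`,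
level `j`, `R_v = {|π(v)| ≤ j}`, `S(v) = μ(R_v)`; a PAIR OBSERVER `{x, y}` (`x ∉ A`, `y` any vertex) with `Π = π(x) ∪ π(y)`,
`|Π| = #{z ∈ A : x ↔ z ∨ y ↔ z}`; the `c`-free event `F = {c ↮ x ∧ c ↮ y}`;
`U_c = μ(F ∩ {1 ≤ |Π| ≤ j})`, `V_c = μ(F ∩ R_c)`.

The QG family of the lemma factory (run/shared/lean/prim/prim-lf-8/QG-FAMILY-ROOT.md) has the single-observer root TTP ⇒ STCS2 ⇒
QP ⇒ QG ⇒ CIL (typed in `…TformTopPackingReduction`, `…SharpTCSReduction`, `…QuantGapReductions`).  Its PAIR members are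

* **QP₂(c,t)** (pair two-level packing):  `U_c · S(c) ≤ V_c · t`   for a threshold `t` with `S(a) ≤ t ≤ S(c)` (`a ∈ A ∖ c`);
* **QG₂(c,t)** (quantitative pair gap):   `(S(c) − t) · μ(F) ≤ V_c − U_c`;
* **CS₂** (`stub_championStabilityPair`): `U_c ≤ V_c` at a champion `c`.

This file types the chain  STCS2(|S| = 2) ⇒ QP₂ ⇒ QG₂ ⇒ CS₂ ⇒ crux:
`pairTwoLevelPacking_of_sharpTCSPair` (drop `{|Π| ≥ 1}` on the right), `quantGapPair_of_pairTwoLevelPacking` (one Harris step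
`V_c ≥ μ(F)·S(c)`, two decreasing events), `championStabilityPair_of_pairTwoLevelPacking` (`t = S(c)`),
`noHeavyLowerTail_of_pairTwoLevelPacking` (through the landed `noHeavyLowerTail_of_championStabilityPair`), `noHeavyLowerTail_of_sharpTCSPair`.
Census backing (0 violations): ttrl2 lf8qg RESULT (b) FINAL — QG₂ 779 180 905 `(c,x,y)` cases, CS₂ same pass; ttrl2 tcs — STCS2 for
observer sets; seat screen of QP₂ itself `lab/qp2_screen.py` (0 / 9 939 champion cases, `y` free or relay; the any-`c` single-observer
QP fails at non-champions, 99 / 7 210).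
-/

noncomputable section

namespace Summit.CriticalPhenomena.PercolationContinuityZ3.Theorems

open MeasureTheory Set Literature.Probability.LatticeModels Literature.Probability.Percolation
open scoped Classical BigOperators

variable {n : ℕ}

namespace PairTwoLevelPacking

/-- The `c`-free event `{c ↮ x ∧ c ↮ y}` is decreasing. [folklore] -/
theorem isLowerSet_cfree (c x y : Fin n) :
    IsLowerSet {ω : BondConfig (Fin n) | ω ∉ openConn c x ∧ ω ∉ openConn c y} := by
  intro ω ω' hle hω
  exact ⟨fun h => hω.1 (isUpperSet_openConn c x hle h), fun h => hω.2 (isUpperSet_openConn c y hle h)⟩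

/-- **Harris for the pair's `c`-free world**: `μ(F) · S(c) ≤ μ(F ∩ R_c) = V_c` (two decreasing events). [folklore] -/
theorem real_cfree_mul_light_le (w : Sym2 (Fin n) → unitInterval) (A : Finset (Fin n)) (c x y : Fin n) (j : ℕ) :
    (prodBernoulli w).real {ω : BondConfig (Fin n) | ω ∉ openConn c x ∧ ω ∉ openConn c y} *
        (prodBernoulli w).real {ω : BondConfig (Fin n) | (A.filter fun z => ω ∈ openConn c z).card ≤ j} ≤
      (prodBernoulli w).real {ω : BondConfig (Fin n) | ω ∉ openConn c x ∧ ω ∉ openConn c y ∧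
        (A.filter fun z => ω ∈ openConn c z).card ≤ j} := by
  have h : {ω : BondConfig (Fin n) | ω ∉ openConn c x ∧ ω ∉ openConn c y ∧
      (A.filter fun z => ω ∈ openConn c z).card ≤ j} =
      {ω : BondConfig (Fin n) | ω ∉ openConn c x ∧ ω ∉ openConn c y} ∩
        {ω | (A.filter fun z => ω ∈ openConn c z).card ≤ j} := by
    ext ω; simp only [mem_setOf_eq, mem_inter_iff, and_assoc]
  rw [h]
  exact prodBernoulli_harris_lower w (isLowerSet_cfree c x y) (PrefixPacking.isLowerSet_cardLe A c j)
    MeasurableSet.of_discrete MeasurableSet.of_discrete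

/-- **Cover for the degenerate case.**  If the pair's block holds between `1` and `j` relays, some relay is light:
`{1 ≤ |Π| ≤ j} ⊆ ⋃_{z ∈ A} R_z` (a relay `z ∈ Π` has `π(z) ⊆ Π`). [folklore] -/
theorem pairSmall_subset_biUnion (A : Finset (Fin n)) (x y : Fin n) (j : ℕ) :
    {ω : BondConfig (Fin n) | 1 ≤ (A.filter fun z => ω ∈ openConn x z ∨ ω ∈ openConn y z).card ∧
        (A.filter fun z => ω ∈ openConn x z ∨ ω ∈ openConn y z).card ≤ j} ⊆
      ⋃ z ∈ A, {ω : BondConfig (Fin n) | (A.filter fun u => ω ∈ openConn z u).card ≤ j} := by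
  rintro ω ⟨h1, hj⟩
  obtain ⟨z, hz⟩ := Finset.card_pos.1 h1
  obtain ⟨hzA, hz'⟩ := Finset.mem_filter.1 hz
  refine Set.mem_iUnion₂.2 ⟨z, hzA, ?_⟩
  show (A.filter fun u => ω ∈ openConn z u).card ≤ j
  refine le_trans (Finset.card_le_card fun u hu => ?_) hj
  obtain ⟨huA, hzu⟩ := Finset.mem_filter.1 hu
  refine Finset.mem_filter.2 ⟨huA, ?_⟩
  have hzu' : (openGraph ω).Reachable z u := hzu
  rcases hz' with hxz | hyz
  · exact Or.inl (show (openGraph ω).Reachable x u from (show (openGraph ω).Reachable x z from hxz).trans hzu')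
  · exact Or.inr (show (openGraph ω).Reachable y u from (show (openGraph ω).Reachable y z from hyz).trans hzu')

end PairTwoLevelPacking

open PairTwoLevelPacking

/-- **STCS2 for a pair ⇒ QP₂** (drop the attachment indicator `{|Π| ≥ 1}` on the right-hand side). [this file] -/
theorem pairTwoLevelPacking_of_sharpTCSPair (w : Sym2 (Fin n) → unitInterval) (A : Finset (Fin n)) (x y c : Fin n)
    (j : ℕ) (t : ℝ) (ht : 0 ≤ t)
    (hSTCS : (prodBernoulli w).real {ω : BondConfig (Fin n) | ω ∉ openConn c x ∧ ω ∉ openConn c y ∧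
          1 ≤ (A.filter fun z => ω ∈ openConn x z ∨ ω ∈ openConn y z).card ∧
          (A.filter fun z => ω ∈ openConn x z ∨ ω ∈ openConn y z).card ≤ j} *
        (prodBernoulli w).real {ω : BondConfig (Fin n) | (A.filter fun z => ω ∈ openConn c z).card ≤ j} ≤
      (prodBernoulli w).real {ω : BondConfig (Fin n) | ω ∉ openConn c x ∧ ω ∉ openConn c y ∧
          1 ≤ (A.filter fun z => ω ∈ openConn x z ∨ ω ∈ openConn y z).card ∧
          (A.filter fun z => ω ∈ openConn c z).card ≤ j} * t) :
    (prodBernoulli w).real {ω : BondConfig (Fin n) | ω ∉ openConn c x ∧ ω ∉ openConn c y ∧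
          1 ≤ (A.filter fun z => ω ∈ openConn x z ∨ ω ∈ openConn y z).card ∧
          (A.filter fun z => ω ∈ openConn x z ∨ ω ∈ openConn y z).card ≤ j} *
        (prodBernoulli w).real {ω : BondConfig (Fin n) | (A.filter fun z => ω ∈ openConn c z).card ≤ j} ≤
      (prodBernoulli w).real {ω : BondConfig (Fin n) | ω ∉ openConn c x ∧ ω ∉ openConn c y ∧
          (A.filter fun z => ω ∈ openConn c z).card ≤ j} * t := by
  refine hSTCS.trans (mul_le_mul_of_nonneg_right (measureReal_mono ?_ (measure_ne_top _ _)) ht)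
  rintro ω ⟨hcx, hcy, -, hle⟩
  exact ⟨hcx, hcy, hle⟩

/-- **QP₂ ⇒ QG₂ at the same relay `c` and threshold `t`** (`0 ≤ t ≤ S(c)`, and `S(a) ≤ t` for `a ∈ A ∖ c`):
from `U_c·S(c) ≤ V_c·t` one gets `(S(c) − t)·μ(F) ≤ V_c − U_c`, by the Harris step `μ(F)·S(c) ≤ V_c`.
In the degenerate case `S(c) = 0` every relay is a.s. heavy and `U_c = 0` by the cover `pairSmall_subset_biUnion`. [this file] -/
theorem quantGapPair_of_pairTwoLevelPacking (w : Sym2 (Fin n) → unitInterval) (A : Finset (Fin n)) (x y c : Fin n)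
    (j : ℕ) (t : ℝ) (ht : 0 ≤ t)
    (hdom : ∀ a ∈ A, a ≠ c →
      (prodBernoulli w).real {ω : BondConfig (Fin n) | (A.filter fun z => ω ∈ openConn a z).card ≤ j} ≤ t)
    (htc : t ≤ (prodBernoulli w).real {ω : BondConfig (Fin n) | (A.filter fun z => ω ∈ openConn c z).card ≤ j})
    (hQP2 : (prodBernoulli w).real {ω : BondConfig (Fin n) | ω ∉ openConn c x ∧ ω ∉ openConn c y ∧
          1 ≤ (A.filter fun z => ω ∈ openConn x z ∨ ω ∈ openConn y z).card ∧
          (A.filter fun z => ω ∈ openConn x z ∨ ω ∈ openConn y z).card ≤ j} *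
        (prodBernoulli w).real {ω : BondConfig (Fin n) | (A.filter fun z => ω ∈ openConn c z).card ≤ j} ≤
      (prodBernoulli w).real {ω : BondConfig (Fin n) | ω ∉ openConn c x ∧ ω ∉ openConn c y ∧
          (A.filter fun z => ω ∈ openConn c z).card ≤ j} * t) :
    ((prodBernoulli w).real {ω : BondConfig (Fin n) | (A.filter fun z => ω ∈ openConn c z).card ≤ j} - t) *
        (prodBernoulli w).real {ω : BondConfig (Fin n) | ω ∉ openConn c x ∧ ω ∉ openConn c y} ≤
      (prodBernoulli w).real {ω : BondConfig (Fin n) | ω ∉ openConn c x ∧ ω ∉ openConn c y ∧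
          (A.filter fun z => ω ∈ openConn c z).card ≤ j} -
      (prodBernoulli w).real {ω : BondConfig (Fin n) | ω ∉ openConn c x ∧ ω ∉ openConn c y ∧
          1 ≤ (A.filter fun z => ω ∈ openConn x z ∨ ω ∈ openConn y z).card ∧
          (A.filter fun z => ω ∈ openConn x z ∨ ω ∈ openConn y z).card ≤ j} := by
  set μ := prodBernoulli w with hμ
  set Sc := μ.real {ω : BondConfig (Fin n) | (A.filter fun z => ω ∈ openConn c z).card ≤ j} with hSc
  set F := μ.real {ω : BondConfig (Fin n) | ω ∉ openConn c x ∧ ω ∉ openConn c y} with hF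
  set V := μ.real {ω : BondConfig (Fin n) | ω ∉ openConn c x ∧ ω ∉ openConn c y ∧
      (A.filter fun z => ω ∈ openConn c z).card ≤ j} with hV
  set U := μ.real {ω : BondConfig (Fin n) | ω ∉ openConn c x ∧ ω ∉ openConn c y ∧
      1 ≤ (A.filter fun z => ω ∈ openConn x z ∨ ω ∈ openConn y z).card ∧
      (A.filter fun z => ω ∈ openConn x z ∨ ω ∈ openConn y z).card ≤ j} with hU
  have hharris : F * Sc ≤ V := real_cfree_mul_light_le w A c x y j
  have hS0 : 0 ≤ Sc := measureReal_nonneg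
  have hF0 : 0 ≤ F := measureReal_nonneg
  have hU0 : 0 ≤ U := measureReal_nonneg
  have hV0 : 0 ≤ V := measureReal_nonneg
  by_cases hSzero : Sc = 0
  · -- then `t = 0`, every relay is a.s. heavy and `U = 0`
    have ht0 : t = 0 := le_antisymm (htc.trans (le_of_eq hSzero)) ht
    have hUle : U ≤ ∑ z ∈ A, μ.real {ω : BondConfig (Fin n) | (A.filter fun u => ω ∈ openConn z u).card ≤ j} := by
      refine (measureReal_mono ?_ (measure_ne_top _ _)).trans (measureReal_biUnion_finset_le A _)
      rintro ω ⟨-, -, h1, hj⟩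
      exact pairSmall_subset_biUnion A x y j ⟨h1, hj⟩
    have hsum0 : ∑ z ∈ A, μ.real {ω : BondConfig (Fin n) | (A.filter fun u => ω ∈ openConn z u).card ≤ j} ≤ 0 := by
      refine Finset.sum_nonpos fun z hz => ?_
      by_cases hzc : z = c
      · rw [hzc]; exact le_of_eq hSzero
      · exact (hdom z hz hzc).trans (le_of_eq ht0)
    have hU00 : U = 0 := le_antisymm (hUle.trans hsum0) hU0
    rw [hSzero, ht0, hU00]
    linarith
  · have hSpos : 0 < Sc := lt_of_le_of_ne hS0 (Ne.symm hSzero)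
    -- `U ≤ V·t/Sc`, so `V − U ≥ V·(Sc − t)/Sc ≥ F·(Sc − t)`
    have key : U * Sc ≤ V * t := hQP2
    have h1 : (V - U) * Sc ≥ V * (Sc - t) := by nlinarith
    have h2 : V * (Sc - t) ≥ F * Sc * (Sc - t) := mul_le_mul_of_nonneg_right hharris (by linarith)
    have h3 : (V - U) * Sc ≥ (Sc - t) * F * Sc := by nlinarith
    exact le_of_mul_le_mul_right (by linarith) hSpos

/-- **QP₂ (all graphs, pair observers `x ∉ A`, champions `c`, admissible thresholds) ⇒ CS₂** — the registered pair stub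
`stub_championStabilityPair` (`U_c ≤ V_c` at every champion), by `quantGapPair_of_pairTwoLevelPacking` with `t = S(c)`. [this file] -/
theorem championStabilityPair_of_pairTwoLevelPacking
    (hQP2 : ∀ (n : ℕ) (w : Sym2 (Fin n) → unitInterval) (A : Finset (Fin n)) (x y c : Fin n) (j : ℕ) (t : ℝ),
      x ∉ A → c ∈ A → 0 ≤ t →
      (∀ a ∈ A, a ≠ c →
        (prodBernoulli w).real {ω : BondConfig (Fin n) | (A.filter fun z => ω ∈ openConn a z).card ≤ j} ≤ t) →
      t ≤ (prodBernoulli w).real {ω : BondConfig (Fin n) | (A.filter fun z => ω ∈ openConn c z).card ≤ j} →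
      (prodBernoulli w).real {ω : BondConfig (Fin n) | ω ∉ openConn c x ∧ ω ∉ openConn c y ∧
          1 ≤ (A.filter fun z => ω ∈ openConn x z ∨ ω ∈ openConn y z).card ∧
          (A.filter fun z => ω ∈ openConn x z ∨ ω ∈ openConn y z).card ≤ j} *
        (prodBernoulli w).real {ω : BondConfig (Fin n) | (A.filter fun z => ω ∈ openConn c z).card ≤ j} ≤
      (prodBernoulli w).real {ω : BondConfig (Fin n) | ω ∉ openConn c x ∧ ω ∉ openConn c y ∧
          (A.filter fun z => ω ∈ openConn c z).card ≤ j} * t) :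
    ∀ (n : ℕ) (w : Sym2 (Fin n) → unitInterval) (A : Finset (Fin n)) (x y c : Fin n) (j : ℕ), x ∉ A → c ∈ A →
      (∀ a ∈ A, (Literature.Probability.LatticeModels.prodBernoulli w).real
          {ω : Literature.Probability.Percolation.BondConfig (Fin n) |
            (A.filter fun z => ω ∈ Literature.Probability.Percolation.openConn a z).card ≤ j} ≤
        (Literature.Probability.LatticeModels.prodBernoulli w).real
          {ω : Literature.Probability.Percolation.BondConfig (Fin n) |
            (A.filter fun z => ω ∈ Literature.Probability.Percolation.openConn c z).card ≤ j}) →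
      (Literature.Probability.LatticeModels.prodBernoulli w).real
          {ω : Literature.Probability.Percolation.BondConfig (Fin n) |
            ω ∉ Literature.Probability.Percolation.openConn c x ∧
            ω ∉ Literature.Probability.Percolation.openConn c y ∧
            1 ≤ (A.filter fun z => ω ∈ Literature.Probability.Percolation.openConn x z ∨
                  ω ∈ Literature.Probability.Percolation.openConn y z).card ∧
            (A.filter fun z => ω ∈ Literature.Probability.Percolation.openConn x z ∨
                  ω ∈ Literature.Probability.Percolation.openConn y z).card ≤ j} ≤
        (Literature.Probability.LatticeModels.prodBernoulli w).real
          {ω : Literature.Probability.Percolation.BondConfig (Fin n) |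
            ω ∉ Literature.Probability.Percolation.openConn c x ∧
            ω ∉ Literature.Probability.Percolation.openConn c y ∧
            (A.filter fun z => ω ∈ Literature.Probability.Percolation.openConn c z).card ≤ j} := by
  intro n w A x y c j hx hc hch
  set Sc := (prodBernoulli w).real {ω : BondConfig (Fin n) | (A.filter fun z => ω ∈ openConn c z).card ≤ j}
    with hSc
  have h := quantGapPair_of_pairTwoLevelPacking w A x y c j Sc measureReal_nonneg
    (fun a ha _ => hch a ha) le_rfl (hQP2 n w A x y c j Sc hx hc measureReal_nonneg (fun a ha _ => hch a ha) le_rfl)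
  have h0 : (Sc - Sc) * (prodBernoulli w).real
      {ω : BondConfig (Fin n) | ω ∉ openConn c x ∧ ω ∉ openConn c y} = 0 := by ring
  linarith

/-- **The pair two-level packing closes the crux `NoHeavyLowerTail`** (QP₂ ⇒ CS₂ ⇒ MS ⇒ CIL ⇒ crux, through the landed
`noHeavyLowerTail_of_championStabilityPair`). [this file] -/
theorem noHeavyLowerTail_of_pairTwoLevelPacking
    (hQP2 : ∀ (n : ℕ) (w : Sym2 (Fin n) → unitInterval) (A : Finset (Fin n)) (x y c : Fin n) (j : ℕ) (t : ℝ),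
      x ∉ A → c ∈ A → 0 ≤ t →
      (∀ a ∈ A, a ≠ c →
        (prodBernoulli w).real {ω : BondConfig (Fin n) | (A.filter fun z => ω ∈ openConn a z).card ≤ j} ≤ t) →
      t ≤ (prodBernoulli w).real {ω : BondConfig (Fin n) | (A.filter fun z => ω ∈ openConn c z).card ≤ j} →
      (prodBernoulli w).real {ω : BondConfig (Fin n) | ω ∉ openConn c x ∧ ω ∉ openConn c y ∧
          1 ≤ (A.filter fun z => ω ∈ openConn x z ∨ ω ∈ openConn y z).card ∧
          (A.filter fun z => ω ∈ openConn x z ∨ ω ∈ openConn y z).card ≤ j} *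
        (prodBernoulli w).real {ω : BondConfig (Fin n) | (A.filter fun z => ω ∈ openConn c z).card ≤ j} ≤
      (prodBernoulli w).real {ω : BondConfig (Fin n) | ω ∉ openConn c x ∧ ω ∉ openConn c y ∧
          (A.filter fun z => ω ∈ openConn c z).card ≤ j} * t) :
    Summit.CriticalPhenomena.PercolationContinuityZ3.Theses.PercNearOneGluing.NoHeavyLowerTail :=
  noHeavyLowerTail_of_championStabilityPair (championStabilityPair_of_pairTwoLevelPacking hQP2)

/-- **STCS2 for pair observers (all graphs, `x ∉ A`, champions `c`, admissible thresholds) closes the crux**, through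
`pairTwoLevelPacking_of_sharpTCSPair` and `noHeavyLowerTail_of_pairTwoLevelPacking`. [this file] -/
theorem noHeavyLowerTail_of_sharpTCSPair
    (hSTCS : ∀ (n : ℕ) (w : Sym2 (Fin n) → unitInterval) (A : Finset (Fin n)) (x y c : Fin n) (j : ℕ) (t : ℝ),
      x ∉ A → c ∈ A → 0 ≤ t →
      (∀ a ∈ A, a ≠ c →
        (prodBernoulli w).real {ω : BondConfig (Fin n) | (A.filter fun z => ω ∈ openConn a z).card ≤ j} ≤ t) →
      t ≤ (prodBernoulli w).real {ω : BondConfig (Fin n) | (A.filter fun z => ω ∈ openConn c z).card ≤ j} →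
      (prodBernoulli w).real {ω : BondConfig (Fin n) | ω ∉ openConn c x ∧ ω ∉ openConn c y ∧
          1 ≤ (A.filter fun z => ω ∈ openConn x z ∨ ω ∈ openConn y z).card ∧
          (A.filter fun z => ω ∈ openConn x z ∨ ω ∈ openConn y z).card ≤ j} *
        (prodBernoulli w).real {ω : BondConfig (Fin n) | (A.filter fun z => ω ∈ openConn c z).card ≤ j} ≤
      (prodBernoulli w).real {ω : BondConfig (Fin n) | ω ∉ openConn c x ∧ ω ∉ openConn c y ∧
          1 ≤ (A.filter fun z => ω ∈ openConn x z ∨ ω ∈ openConn y z).card ∧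
          (A.filter fun z => ω ∈ openConn c z).card ≤ j} * t) :
    Summit.CriticalPhenomena.PercolationContinuityZ3.Theses.PercNearOneGluing.NoHeavyLowerTail :=
  noHeavyLowerTail_of_pairTwoLevelPacking fun n w A x y c j t hx hc ht hdom htc =>
    pairTwoLevelPacking_of_sharpTCSPair w A x y c j t ht (hSTCS n w A x y c j t hx hc ht hdom htc)

end Summit.CriticalPhenomena.PercolationContinuityZ3.Theorems

end
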